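import Summits.RiemannHypothesis.RiemannHypothesis.Theorems.Splittings.LiOneSidedCriteriaTwist
import HarnessLib

/-!
# Splittings — Li bridge lens, ONE-SIDED SUB-EXPONENTIAL ENVELOPES of `λ_n`, part 3/4: the `q = 1` criteria from EITHER side,
# increments, and why the `ζ`-specific input is needed — SPLIT-li-bridge gen 4

Cell rh-split, seat rh-split-li-bridge g4 (brief sha16 f79c5f09d8bcb036), card
`run/shared/lean/pub/rh-split/cards/SPLIT-li-bridge.md` §11; zero-definition raw form of
`HOME/rh-split-li-bridge/SketchG4.lean` (sha16 00b14b55d9ac9472; referee rh-split-ref g2 verdict 2026-08-27T03:19:00Z: §11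
DELIVERABLE, farm rc 0 / 0 warn / 0 sorry, std axioms on `rh_iff_liSubexpUpper`, `rh_iff_liCesaroBddBelow`; CONTENT PRE-FILE
PASS «LiOneSidedCriteria{,Cesaro} zero-def carve (§11.3 excluded)»), filed by rh-split-typer-1 g4 in four parts
(`LiOneSidedCriteriaCore`, `LiOneSidedCriteriaTwist`, `LiOneSidedCriteria`, `LiOneSidedCriteriaCesaro`; the 400-line rule).
NOT CARRIED (card §11.3 = the scratch's file-§§8–9 progression rows, CONDITIONAL BOOKKEEPING on unprinted non-resonance):
the two defs `LiProgFloor` / `LiProgNonResonance` and `rh_of_nonResonance_progFloor`, `nonResonance_one`,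
`liPhi_ne_zero_of_rh` (tree: `Literature.NumberTheory.LFunctions.liPhi_ne_zero_of_rh`), `nonResonance_of_rh`,
`rh_iff_nonResonance_and_progFloor`.  The RH-free lemma `resonance_of_progFloor` is kept with `LiProgFloor σ q a` SPELLED OUT
(it is the engine of the `q = 1` criteria), and `rh_of_liFloor` is re-routed through it at `q = 1` (the scratch went through
`rh_of_nonResonance_progFloor` + `nonResonance_one`; same argument, `Finset.range 1` has no `j ≠ 0`).  Proofs otherwise verbatim;
docstrings added where the scratch had none.
HONEST LABEL: «SPLITTING SEARCH over kernel-typed RH-EQUIVALENCES; a splitting A ∧ B ⟹ RH is CONDITIONAL bookkeeping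
unless A and B are both proved; nothing here bears on the truth of RH.»  Every theorem below is an RH-EQUIVALENCE (neither side
asserted) or an RH-FREE implication whose hypothesis is of RH strength; `Summit.RiemannHypothesis` appears only as a
conclusion of such implications or as a hypothesis.

This part (referee g2 03:19:00Z: «upper / increment iffs = NEW KERNEL RH-EQUIVALENT CRITERIA (FIN-free; criteria, not splittings, by
the tautology test); lower floor = the `ζ`-instance of the tree's Bombieri–Lagarias sub-exponential theorem»):
* §10 `rh_of_liFloor`: `(∀ ε>0 ∃ C n₀ ∀ n≥n₀, -C e^{εn} ≤ σ λ_n) → RH` for `σ = ±1` (via part 2's `resonance_of_progFloor` at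
  `q = 1`); the UPPER criterion `rh_of_liSubexpUpper` («Li's criterion from above»: `λ_n ≤ C(ε) e^{εn}` ⟹ RH); the LOWER one
  (`rh_of_liSubexpLower`; `rh_of_liSubexpLower_tree` = the same from the tree's theorem); converses from the tree's Oesterlé–Voros
  law (`liSubexpUpper_of_rh`) and Li positivity (`liSubexpLower_of_rh`); the iff's `rh_iff_liSubexpUpper`,
  `rh_iff_liSubexpLower`, `rh_iff_liSubexpTwoSided` (the sequence form of Keiper's «radius of convergence 1»), `rh_iff_liFloor`;
* §11 increments: `σ (λ_{n+1} - λ_n) ≥ -C(ε)e^{εn}` ⟹ RH (either sign; `floor_of_incrFloor`, `rh_of_liIncrFloor`), with the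
  converse (`liIncrFloor_of_rh`) and `rh_iff_liIncrFloor`;
* §14 `multiset_upper_counterexample`: the UPPER criterion FAILS for general Bombieri–Lagarias multisets (zero images
  `{2, 2ζ₃, 2ζ₃²}`: Li sums bounded above by `3`, unbounded below) — for `ζ` it holds because `ξ > 0` on `ℝ` forbids a zero image
  on the positive axis of the least-modulus circle (part 2, `liPhi_ofReal_ne_zero`).
-/

set_option linter.dupNamespace false

noncomputable section

open Complex Filter Topology Finset
open scoped Nat Real ComplexOrder ComplexConjugate

namespace Summit.RiemannHypothesis.RiemannHypothesis.Theorems.Splittings.LiOneSidedCriteria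

open Literature.NumberTheory.LFunctions
open Summit.RiemannHypothesis.RiemannHypothesis.Theorems.Splittings
open Summit.RiemannHypothesis.RiemannHypothesis.Theorems.Splittings.LiProgression

/-! ## 10. The `q = 1` criteria: one-sided sub-exponential envelopes from EITHER side -/

/-- **One-sided floor of either sign ⟹ RH.** `σ = 1`: Bombieri–Lagarias (c) ⟹ (a) (tree:
`riemannHypothesis_of_keiperLiCoeff_subexp`); `σ = -1`: the UPPER criterion.  Proof: a zero of `φ` in the unit disc would, by
part 2's `resonance_of_progFloor` at `q = 1`, `a = 0`, produce a resonance index `j ∈ Finset.range 1` with `j ≠ 0` — there is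
none (the scratch routed this through `rh_of_nonResonance_progFloor` + `nonResonance_one`; same argument). -/
theorem rh_of_liFloor {σ : ℝ} (hσ : σ = 1 ∨ σ = -1)
    (h : ∀ ε : ℝ, 0 < ε → ∃ C : ℝ, ∃ n₀ : ℕ, ∀ n : ℕ, n₀ ≤ n →
      -C * Real.exp (ε * n) ≤ σ * keiperLiCoeff n) : Summit.RiemannHypothesis := by
  refine riemannHypothesis_of_liPhi_ne_zero fun z₁ hz₁ hz₁0 ↦ ?_
  have hFloor : ∀ ε : ℝ, 0 < ε → ∃ C : ℝ, ∃ k₀ : ℕ, ∀ k : ℕ, k₀ ≤ k →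
      -C * Real.exp (ε * ((1 * k + 0 : ℕ) : ℝ)) ≤ σ * keiperLiCoeff (1 * k + 0) := by
    intro ε hε
    obtain ⟨C, n₀, hn₀⟩ := h ε hε
    refine ⟨C, n₀, fun k hk ↦ ?_⟩
    have := hn₀ k hk
    simpa only [one_mul, add_zero] using this
  obtain ⟨z₀, -, -, -, -, j, hj, hj0, -⟩ := resonance_of_progFloor hσ le_rfl hFloor hz₁ hz₁0
  have : j = 0 := by have := Finset.mem_range.1 hj; omega
  exact absurd this hj0

/-- **UPPER criterion («Li's criterion from above»).** If for every `ε > 0`, `λ_n ≤ C(ε) e^{εn}` for all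
large `n`, then RH.  RH-FREE implication; hypothesis of RH strength. -/
theorem rh_of_liSubexpUpper
    (h : ∀ ε : ℝ, 0 < ε → ∃ C : ℝ, ∃ n₀ : ℕ, ∀ n : ℕ, n₀ ≤ n →
      keiperLiCoeff n ≤ C * Real.exp (ε * n)) : Summit.RiemannHypothesis := by
  refine rh_of_liFloor (σ := -1) (Or.inr rfl) fun ε hε ↦ ?_
  obtain ⟨C, n₀, hn₀⟩ := h ε hε
  exact ⟨C, n₀, fun n hn ↦ by linarith [hn₀ n hn]⟩

/-- **LOWER criterion** (Bombieri–Lagarias (c) ⟹ (a)), here in the `∃ n₀` form; second proof via the tree. -/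
theorem rh_of_liSubexpLower
    (h : ∀ ε : ℝ, 0 < ε → ∃ C : ℝ, ∃ n₀ : ℕ, ∀ n : ℕ, n₀ ≤ n →
      -C * Real.exp (ε * n) ≤ keiperLiCoeff n) : Summit.RiemannHypothesis := by
  refine rh_of_liFloor (σ := 1) (Or.inl rfl) fun ε hε ↦ ?_
  obtain ⟨C, n₀, hn₀⟩ := h ε hε
  exact ⟨C, n₀, fun n hn ↦ by linarith [hn₀ n hn]⟩

/-- The same LOWER criterion from the TREE's Bombieri–Lagarias theorem (in-tree status record). -/
theorem rh_of_liSubexpLower_tree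
    (h : ∀ ε : ℝ, 0 < ε → ∃ C : ℝ, ∃ n₀ : ℕ, ∀ n : ℕ, n₀ ≤ n →
      -C * Real.exp (ε * n) ≤ keiperLiCoeff n) : Summit.RiemannHypothesis := by
  refine riemannHypothesis_of_keiperLiCoeff_subexp fun ε hε ↦ ?_
  obtain ⟨C, n₀, hn₀⟩ := h ε hε
  set H : ℝ := ∑ m ∈ Finset.range n₀, |keiperLiCoeff m| with hH
  have hH0 : 0 ≤ H := Finset.sum_nonneg fun m _ ↦ abs_nonneg _
  refine ⟨|C| + H + 1, by positivity, fun n _ ↦ ?_⟩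
  have hexp : 1 ≤ Real.exp (ε * n) := Real.one_le_exp (by positivity)
  have hexp0 : 0 < Real.exp (ε * n) := Real.exp_pos _
  by_cases hn : n₀ ≤ n
  · have h1 := hn₀ n hn
    have h2 : -|C| * Real.exp (ε * n) ≤ -C * Real.exp (ε * n) :=
      mul_le_mul_of_nonneg_right (neg_le_neg (le_abs_self C)) hexp0.le
    nlinarith [abs_nonneg C]
  · have hmem : n ∈ Finset.range n₀ := Finset.mem_range.2 (by omega)
    have hle : |keiperLiCoeff n| ≤ H :=
      Finset.single_le_sum (f := fun m ↦ |keiperLiCoeff m|) (fun m _ ↦ abs_nonneg _) hmem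
    have := neg_abs_le (keiperLiCoeff n)
    nlinarith [abs_nonneg C]

/-- RH ⟹ the upper envelope (indeed `λ_n ≤ n²` eventually, from the Oesterlé–Voros law in the tree). -/
theorem liSubexpUpper_of_rh (hRH : Summit.RiemannHypothesis) :
    ∀ ε : ℝ, 0 < ε → ∃ C : ℝ, ∃ n₀ : ℕ, ∀ n : ℕ, n₀ ≤ n →
      keiperLiCoeff n ≤ C * Real.exp (ε * n) := by
  intro ε hε
  have hV := Voros2006_thm_onlyif_holds hRH
  have h1 := hV.def zero_lt_one
  obtain ⟨n₀, hn₀⟩ := eventually_atTop.1 (h1.and (eventually_ge_atTop 1))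
  refine ⟨4 / ε ^ 2, n₀, fun n hn ↦ ?_⟩
  obtain ⟨hb, hn1⟩ := hn₀ n hn
  rw [Real.norm_eq_abs, Real.norm_eq_abs, Nat.abs_cast, one_mul] at hb
  have hn0 : (1 : ℝ) ≤ n := by exact_mod_cast hn1
  have hlog : Real.log n ≤ n := (Real.log_le_sub_one_of_pos (by linarith)).trans (by linarith)
  have hγ : Real.eulerMascheroniConstant < 1 := by
    have := Real.eulerMascheroniConstant_lt_two_thirds; linarith
  have hlog2π : 0 < Real.log (2 * Real.pi) := Real.log_pos (by linarith [Real.pi_gt_three])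
  have hmain : (n : ℝ) / 2 * (Real.log n - 1 + Real.eulerMascheroniConstant - Real.log (2 * Real.pi))
      ≤ (n : ℝ) / 2 * n := by
    refine mul_le_mul_of_nonneg_left ?_ (by positivity)
    linarith
  have hnn : (n : ℝ) ≤ (n : ℝ) ^ 2 := by nlinarith
  have hlam : keiperLiCoeff n ≤ 2 * (n : ℝ) ^ 2 := by
    have := (abs_le.1 hb).2
    nlinarith
  -- `2n² ≤ (4/ε²)·e^{εn}`: from `x²/2 ≤ e^x` at `x = ε n`
  have hx : (ε * n) ^ 2 / 2 ≤ Real.exp (ε * n) := by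
    have := Real.pow_div_factorial_le_exp (ε * n) (by positivity) 2
    simpa using this
  have hx' : ε ^ 2 * (n : ℝ) ^ 2 ≤ 2 * Real.exp (ε * n) := by
    rw [mul_pow] at hx
    linarith
  have hε2 : 0 < ε ^ 2 := by positivity
  have : 2 * (n : ℝ) ^ 2 ≤ 4 / ε ^ 2 * Real.exp (ε * n) := by
    rw [div_mul_eq_mul_div, le_div_iff₀ hε2]
    linarith
  linarith

/-- RH ⟹ the lower envelope (Li/Keiper positivity under RH, tree `li_criterion_holds`). -/
theorem liSubexpLower_of_rh (hRH : Summit.RiemannHypothesis) :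
    ∀ ε : ℝ, 0 < ε → ∃ C : ℝ, ∃ n₀ : ℕ, ∀ n : ℕ, n₀ ≤ n →
      -C * Real.exp (ε * n) ≤ keiperLiCoeff n := by
  intro ε _
  refine ⟨1, 1, fun n hn ↦ ?_⟩
  have h := (li_criterion_holds.1 hRH) n hn
  have := Real.exp_pos (ε * n)
  linarith

/-- **RH ⟺ `λ_n ≤ C(ε) e^{εn}` (every `ε > 0`, all large `n`).** RH-EQUIVALENT; neither side asserted. -/
theorem rh_iff_liSubexpUpper :
    Summit.RiemannHypothesis ↔ ∀ ε : ℝ, 0 < ε → ∃ C : ℝ, ∃ n₀ : ℕ, ∀ n : ℕ, n₀ ≤ n →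
      keiperLiCoeff n ≤ C * Real.exp (ε * n) :=
  ⟨liSubexpUpper_of_rh, rh_of_liSubexpUpper⟩

/-- **RH ⟺ `λ_n ≥ -C(ε) e^{εn}`** (Bombieri–Lagarias (a) ⟺ (c), `∃ n₀` form). RH-EQUIVALENT. -/
theorem rh_iff_liSubexpLower :
    Summit.RiemannHypothesis ↔ ∀ ε : ℝ, 0 < ε → ∃ C : ℝ, ∃ n₀ : ℕ, ∀ n : ℕ, n₀ ≤ n →
      -C * Real.exp (ε * n) ≤ keiperLiCoeff n :=
  ⟨liSubexpLower_of_rh, rh_of_liSubexpLower⟩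

/-- **RH ⟺ `|λ_n| ≤ C(ε) e^{εn}`** (the sequence form of Keiper's «radius of convergence 1»). RH-EQUIVALENT. -/
theorem rh_iff_liSubexpTwoSided :
    Summit.RiemannHypothesis ↔ ∀ ε : ℝ, 0 < ε → ∃ C : ℝ, ∃ n₀ : ℕ, ∀ n : ℕ, n₀ ≤ n →
      |keiperLiCoeff n| ≤ C * Real.exp (ε * n) := by
  constructor
  · intro h ε hε
    obtain ⟨C, n₀, hn₀⟩ := liSubexpUpper_of_rh h ε hε
    refine ⟨|C| + 1, max n₀ 1, fun n hn ↦ ?_⟩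
    have hn1 : 1 ≤ n := le_trans (le_max_right _ _) hn
    have h0 := (li_criterion_holds.1 h) n hn1
    have h1 := hn₀ n (le_trans (le_max_left _ _) hn)
    have hexp0 : 0 < Real.exp (ε * n) := Real.exp_pos _
    rw [abs_of_nonneg h0]
    nlinarith [le_abs_self C]
  · intro h
    refine rh_of_liSubexpUpper fun ε hε ↦ ?_
    obtain ⟨C, n₀, hn₀⟩ := h ε hε
    exact ⟨C, n₀, fun n hn ↦ (le_abs_self _).trans (hn₀ n hn)⟩

/-! ## 11. Increments: `σ(λ_{n+1} - λ_n) ≥ -C(ε) e^{εn}` ⟹ RH (either sign) -/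

/-- A sub-exponential floor on increments integrates to a sub-exponential floor. -/
theorem floor_of_incrFloor {x : ℕ → ℝ}
    (h : ∀ ε : ℝ, 0 < ε → ∃ C : ℝ, ∃ n₀ : ℕ, ∀ n : ℕ, n₀ ≤ n → -C * Real.exp (ε * n) ≤ x (n + 1) - x n) :
    ∀ ε : ℝ, 0 < ε → ∃ C : ℝ, ∃ n₀ : ℕ, ∀ n : ℕ, n₀ ≤ n → -C * Real.exp (ε * n) ≤ x n := by
  intro ε hε
  obtain ⟨C, n₀, hn₀⟩ := h (ε / 2) (by linarith)
  -- by induction: `x n ≥ x n₀ - |C| (n - n₀) e^{(ε/2) n}` for `n ≥ n₀`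
  have step : ∀ n : ℕ, n₀ ≤ n → x n₀ - |C| * n * Real.exp (ε / 2 * n) ≤ x n := by
    intro n hn
    induction n, hn using Nat.le_induction with
    | base =>
      have : 0 ≤ |C| * n₀ * Real.exp (ε / 2 * n₀) := by positivity
      linarith
    | succ m hm ih =>
      have h1 := hn₀ m hm
      have h2 : -|C| * Real.exp (ε / 2 * m) ≤ -C * Real.exp (ε / 2 * m) :=
        mul_le_mul_of_nonneg_right (neg_le_neg (le_abs_self C)) (Real.exp_pos _).le
      have h3 : Real.exp (ε / 2 * m) ≤ Real.exp (ε / 2 * ((m + 1 : ℕ) : ℝ)) :=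
        Real.exp_le_exp.2 (by push_cast; nlinarith)
      have h4 : |C| * m * Real.exp (ε / 2 * m) + |C| * Real.exp (ε / 2 * m)
          ≤ |C| * ((m + 1 : ℕ) : ℝ) * Real.exp (ε / 2 * ((m + 1 : ℕ) : ℝ)) := by
        have hC := abs_nonneg C
        have : |C| * m * Real.exp (ε / 2 * m) + |C| * Real.exp (ε / 2 * m)
            = |C| * ((m + 1 : ℕ) : ℝ) * Real.exp (ε / 2 * m) := by push_cast; ring
        rw [this]
        exact mul_le_mul_of_nonneg_left h3 (by positivity)
      linarith
  refine ⟨|C| * (2 / ε) + |x n₀|, n₀, fun n hn ↦ ?_⟩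
  have hs := step n hn
  -- `n ≤ (2/ε) e^{(ε/2) n}` and `e^{(ε/2)n} e^{(ε/2)n} = e^{εn}`
  have hn2 : (n : ℝ) ≤ 2 / ε * Real.exp (ε / 2 * n) := by
    have h1 : ε / 2 * n + 1 ≤ Real.exp (ε / 2 * n) := Real.add_one_le_exp _
    rw [div_mul_eq_mul_div, le_div_iff₀ hε]
    nlinarith
  have hee : Real.exp (ε / 2 * n) * Real.exp (ε / 2 * n) = Real.exp (ε * n) := by
    rw [← Real.exp_add]; ring_nf
  have hexp1 : 1 ≤ Real.exp (ε * n) := Real.one_le_exp (by positivity)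
  have hC := abs_nonneg C
  have hE := (Real.exp_pos (ε / 2 * n)).le
  have h5 : |C| * n * Real.exp (ε / 2 * n) ≤ |C| * (2 / ε) * Real.exp (ε * n) := by
    rw [← hee]
    have := mul_le_mul_of_nonneg_right hn2 hE
    nlinarith [mul_le_mul_of_nonneg_left this hC]
  have h6 : -|x n₀| ≤ x n₀ := neg_abs_le _
  have h7 : |x n₀| ≤ |x n₀| * Real.exp (ε * n) := le_mul_of_one_le_right (abs_nonneg _) hexp1
  nlinarith

/-- **Increment criterion, either sign.** `σ(λ_{n+1} - λ_n) ≥ -C(ε)e^{εn}` for every `ε > 0` and all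
large `n` implies RH (`σ = 1`: increments bounded below sub-exponentially — contains «eventually
non-decreasing ⟹ RH»; `σ = -1`: increments bounded ABOVE sub-exponentially). -/
theorem rh_of_liIncrFloor {σ : ℝ} (hσ : σ = 1 ∨ σ = -1)
    (h : ∀ ε : ℝ, 0 < ε → ∃ C : ℝ, ∃ n₀ : ℕ, ∀ n : ℕ, n₀ ≤ n →
      -C * Real.exp (ε * n) ≤ σ * (keiperLiCoeff (n + 1) - keiperLiCoeff n)) :
    Summit.RiemannHypothesis := by
  refine rh_of_liFloor hσ (floor_of_incrFloor (x := fun n ↦ σ * keiperLiCoeff n) fun ε hε ↦ ?_)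
  obtain ⟨C, n₀, hn₀⟩ := h ε hε
  refine ⟨C, n₀, fun n hn ↦ ?_⟩
  have h1 := hn₀ n hn
  have e : σ * (keiperLiCoeff (n + 1) - keiperLiCoeff n)
      = σ * keiperLiCoeff (n + 1) - σ * keiperLiCoeff n := by ring
  show -C * Real.exp (ε * n) ≤ σ * keiperLiCoeff (n + 1) - σ * keiperLiCoeff n
  linarith

/-! ## 15. Increments: the converse, so that §11's increment floors are RH-EQUIVALENCES -/

/-- RH ⟹ the increments `λ_{n+1} − λ_n` have a sub-exponential one-sided floor for EITHER sign
(trivially: `0 ≤ λ_m ≤ (4/ε²)e^{εm}` under RH). -/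
theorem liIncrFloor_of_rh (hRH : Summit.RiemannHypothesis) {σ : ℝ} (hσ : σ = 1 ∨ σ = -1) :
    ∀ ε : ℝ, 0 < ε → ∃ C : ℝ, ∃ n₀ : ℕ, ∀ n : ℕ, n₀ ≤ n →
      -C * Real.exp (ε * n) ≤ σ * (keiperLiCoeff (n + 1) - keiperLiCoeff n) := by
  intro ε hε
  obtain ⟨C, n₀, hn₀⟩ := liSubexpUpper_of_rh hRH ε hε
  have hpos : ∀ m : ℕ, 1 ≤ m → 0 ≤ keiperLiCoeff m := (li_criterion_holds.1 hRH)
  refine ⟨|C| * Real.exp ε, max n₀ 1, fun n hn ↦ ?_⟩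
  have hn0 : n₀ ≤ n := le_trans (le_max_left _ _) hn
  have hn1 : 1 ≤ n := le_trans (le_max_right _ _) hn
  have hE : 0 < Real.exp (ε * n) := Real.exp_pos _
  have hE1 : 1 ≤ Real.exp ε := Real.one_le_exp hε.le
  have hsucc : Real.exp (ε * ((n + 1 : ℕ) : ℝ)) = Real.exp ε * Real.exp (ε * n) := by
    rw [← Real.exp_add]; push_cast; ring_nf
  -- `C e^{εm} ≤ |C| e^{ε} e^{εn}` for `m = n, n+1`
  have hb0 : C * Real.exp (ε * n) ≤ |C| * Real.exp ε * Real.exp (ε * n) := by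
    have h1 : C * Real.exp (ε * n) ≤ |C| * Real.exp (ε * n) :=
      mul_le_mul_of_nonneg_right (le_abs_self C) hE.le
    have h2 : |C| * Real.exp (ε * n) ≤ |C| * Real.exp ε * Real.exp (ε * n) := by
      rw [mul_assoc]
      exact mul_le_mul_of_nonneg_left (le_mul_of_one_le_left hE.le hE1) (abs_nonneg C)
    linarith
  have hb1 : C * Real.exp (ε * ((n + 1 : ℕ) : ℝ)) ≤ |C| * Real.exp ε * Real.exp (ε * n) := by
    rw [hsucc, ← mul_assoc]
    exact mul_le_mul_of_nonneg_right (mul_le_mul_of_nonneg_right (le_abs_self C) (Real.exp_pos _).le)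
      hE.le
  have hun := hn₀ n hn0
  have hun1 := hn₀ (n + 1) (Nat.le_succ_of_le hn0)
  have hpn := hpos n hn1
  have hpn1 := hpos (n + 1) (Nat.le_add_left 1 n)
  rcases hσ with rfl | rfl
  · rw [one_mul]; nlinarith
  · rw [neg_one_mul]; nlinarith

/-- **RH ⟺ sub-exponential one-sided floor on the increments (either sign).** RH-EQUIVALENT; neither side asserted. -/
theorem rh_iff_liIncrFloor {σ : ℝ} (hσ : σ = 1 ∨ σ = -1) :
    Summit.RiemannHypothesis ↔
      ∀ ε : ℝ, 0 < ε → ∃ C : ℝ, ∃ n₀ : ℕ, ∀ n : ℕ, n₀ ≤ n →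
        -C * Real.exp (ε * n) ≤ σ * (keiperLiCoeff (n + 1) - keiperLiCoeff n) :=
  ⟨fun h ↦ liIncrFloor_of_rh h hσ, rh_of_liIncrFloor hσ⟩

/-- **RH ⟺ sub-exponential one-sided floor on `λ_n` itself (either sign).** RH-EQUIVALENT; neither side asserted. -/
theorem rh_iff_liFloor {σ : ℝ} (hσ : σ = 1 ∨ σ = -1) :
    Summit.RiemannHypothesis ↔
      ∀ ε : ℝ, 0 < ε → ∃ C : ℝ, ∃ n₀ : ℕ, ∀ n : ℕ, n₀ ≤ n →
        -C * Real.exp (ε * n) ≤ σ * keiperLiCoeff n := by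
  refine ⟨fun h ε hε ↦ ?_, rh_of_liFloor hσ⟩
  rcases hσ with rfl | rfl
  · obtain ⟨C, n₀, hn₀⟩ := liSubexpLower_of_rh h ε hε
    exact ⟨C, n₀, fun n hn ↦ by rw [one_mul]; exact hn₀ n hn⟩
  · obtain ⟨C, n₀, hn₀⟩ := liSubexpUpper_of_rh h ε hε
    exact ⟨C, n₀, fun n hn ↦ by rw [neg_one_mul, neg_mul]; exact neg_le_neg (hn₀ n hn)⟩

/-! ## 14. Why `ζ`-specific input is needed: the UPPER criterion FAILS for general Bombieri–Lagarias multisets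

The conjugation-closed multiset of three «zeros» `ρ_j = 1/(1 - 2ζ₃^j)` (`j = 0,1,2`; all with `|1 - 1/ρ_j| = 2 > 1`,
i.e. all «off the line» in the sense of [BombieriLagarias1999, Thm 1]) has Li sums
`λ_n = Σ_j Re(1 - (1 - 1/ρ_j)ⁿ) = 3 - 3·2ⁿ·[3 ∣ n]`: BOUNDED ABOVE by `3`, unbounded below.  So «bounded above
sub-exponentially ⟹ (a)» is false at multiset generality; for `ζ` it holds because `ξ > 0` on `ℝ` forbids a zero image
on the positive axis of the least-modulus circle (§10). -/

/-- **The UPPER criterion fails at multiset generality.** For the conjugation-closed multiset of zero images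
`{2, 2ζ₃, 2ζ₃²}` (all of modulus `2 > 1`): the Li sums `Re Σ_j (1 - (2ζ₃^j)ⁿ)` are `≤ 3` for every `n`, equal to
`3 - 3·2ⁿ` when `3 ∣ n` and to `3` otherwise — bounded ABOVE, unbounded below. [cite: BombieriLagarias1999, Thm 1] -/
theorem multiset_upper_counterexample (n : ℕ) :
    (∑ j ∈ Finset.range 3, (1 - (2 * exp (2 * π * I / (3 : ℕ)) ^ j) ^ n)).re ≤ 3 ∧
    (3 ∣ n → (∑ j ∈ Finset.range 3, (1 - (2 * exp (2 * π * I / (3 : ℕ)) ^ j) ^ n)).re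
        = 3 - 3 * 2 ^ n) ∧
    (¬ 3 ∣ n → (∑ j ∈ Finset.range 3, (1 - (2 * exp (2 * π * I / (3 : ℕ)) ^ j) ^ n)).re = 3) := by
  have key : ∑ j ∈ Finset.range 3, (1 - (2 * exp (2 * π * I / (3 : ℕ)) ^ j) ^ n)
      = 3 - 2 ^ n * ∑ j ∈ Finset.range 3, (exp (2 * π * I / (3 : ℕ)) ^ j) ^ n := by
    rw [Finset.sum_sub_distrib, Finset.mul_sum]
    simp only [Finset.sum_const, Finset.card_range, nsmul_eq_mul, Nat.cast_ofNat, mul_one, mul_pow]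
  rw [sum_rootOfUnity_pow_mul (by norm_num : (3 : ℕ) ≠ 0)] at key
  have h2n : (0 : ℝ) < 2 ^ n := by positivity
  refine ⟨?_, fun h ↦ ?_, fun h ↦ ?_⟩
  · rw [key]
    split_ifs with h
    · have e : (3 : ℂ) - 2 ^ n * ((3 : ℕ) : ℂ) = ((3 - 2 ^ n * 3 : ℝ) : ℂ) := by push_cast; ring
      rw [e, Complex.ofReal_re]
      nlinarith
    · norm_num
  · rw [key, if_pos h]
    have e : (3 : ℂ) - 2 ^ n * ((3 : ℕ) : ℂ) = ((3 - 3 * 2 ^ n : ℝ) : ℂ) := by push_cast; ring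
    rw [e, Complex.ofReal_re]
  · rw [key, if_neg h]
    norm_num

end Summit.RiemannHypothesis.RiemannHypothesis.Theorems.Splittings.LiOneSidedCriteria

end
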